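import Summits.NavierStokesRegularity.NavierStokesRegularity.Theorems.ScenarioCensusRowF1FrozenTransfer
import Summits.NavierStokesRegularity.NavierStokesRegularity.Theorems.ScenarioCensusRowF1InviscidTop
import HarnessLib

/-!
# LINE «frozen-top» port, part 6/6: §7 rows `Row_F1fzq` / `Row_F1fz`, Liouville rows, floor `LiveTop`, residual `FreezeSlack` (≡ `Row_F1`); the rows are EXCLUDED
# (`rowF1fzq_holds`, `rowF1fz_holds`), `liveTop_holds`, displays, `freezeSlack_iff_rowF1`; census KEYS `Row_F1fzq` / `Row_F1fz` + `_excluded`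

Re-homed for the scenario census (typer seat ns-census-typer-1 g8; the cells F1fzq ⊇ F1fz are MEMBERS OF RECORD «DECIDED IN KERNEL IN FILES» of row F1 since census
v1.72 (critic idea-crit-3 g7 PASS — no price 23:50:38Z; ref ns-census-ref g9 PRE-CHECK ✓ §14.21 item 32 (shim probe a49fdeaa); lead-presearch label); this port makes
them TREE-decided): VERBATIM PORT of ns-idea-3 LINE 20 «frozen-top», `pub/ideators/ns-idea-3/lines/frozen-top/line-frozen-top.lean` sha16 edc3c151346cc4e4 (1610 l.,
0 sorry; the critic's / ref's farm runs went through a shim because the line's import `Literature.Analysis.FunctionSpaces.WeakTimeDerivativeClassical` had no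
farm build — in this port that import is carried only by the part that uses it, `…FrozenPairing` (`FunctionSpaces.sub_eq_intervalIntegral_of_forall_test` in
`pairing_eq_of_weakEquilibrium`)), split for the 400-line rule into `ScenarioCensusRowF1Frozen` (§1–§2 with the `C²_loc`
tool) → `…FrozenThird` (`C³_loc`) → `…FrozenPairing` (§4a) → `…FrozenKill` (§4b) → `…FrozenTransfer` (§5–§6) → `…FrozenTop` (§7 + census KEYS).  Lean text VERBATIM in namespace `…Theorems.ScenarioCensus.FrozenTop` (the line's `…Cruxes.ScenarioCensusRowF1.FrozenTopLine`
re-homed); port edits: the WTDC import moved to the one part that needs it, `@[conjecture]` on the residual `FreezeSlack` (≡ `ScenarioCensus.Row_F1`, OPEN), five one-line docstrings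
added (gate lint).

No census VALUE is moved here (row F1 stays OPEN-WITH-LINE; the members become TREE-decided by name); NS regularity is NOT proved; `Row_F1` is untouched
(zero movement, `freezeSlack_iff_rowF1`); no summit statement is proved by this file. Lemmas that restate already-landed tree declarations are taken BY NAME (gate lint `dedup.landed`): `fderiv_smul_stPull_apply` = `InviscidTop.fderiv_smul_stPull_apply`, `fderiv_smul_stPull` = `InviscidTop.fderiv_smul_stPull`, `fderiv_fderiv_smul_stPull` = `InviscidTop.fderiv_fderiv_smul_stPull`, `fderiv_fderiv_zoom` = `InviscidTop.fderiv_fderiv_zoom`, `tendsto_clm_of_tendsto_apply` = `InviscidTop.tendsto_clm_of_tendsto_apply`, `tendsto_fderiv_fderiv_apply_of_bound` = `InviscidTop.tendsto_fderiv_fderiv_apply_of_bound`, `tendsto_fderiv_fderiv_of_bound` = `InviscidTop.tendsto_fderiv_fderiv_of_bound`, `tendsto_fderiv_fderiv_of_typeI_seq_Ioo` = `InviscidTop.tendsto_fderiv_fderiv_of_typeI_seq_Ioo`, `tendsto_fderiv_fderiv_of_isTypeIAncientMild_seq` = `InviscidTop.tendsto_fderiv_fderiv_of_isTypeIAncientMild_seq`,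 `sing_of_not_bounded` = `InviscidTop.sing_of_not_bounded`, `tendsto_physicalTime` = `ColumnarTop.tendsto_physicalTime`, `eventually_fast` = `ColumnarTop.eventually_fast`, `sqrt_timeLag` = `StretchedTop.sqrt_timeLag`, `forall_of_forall_ne_zero` = `StretchedTop.forall_of_forall_ne_zero`, `vorticitySteady_ancient_trivial` = `eq_zero_of_vorticitySteady`.
-/

-- the summit and its single problem share the name `NavierStokesRegularity` (D-0017 nested layout)
set_option linter.dupNamespace false

noncomputable section

open MeasureTheory Set Function Filter TopologicalSpace Metric
open scoped Topology NNReal ENNReal InnerProductSpace RealInnerProductSpace Laplacian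

namespace Summit.NavierStokesRegularity.NavierStokesRegularity.Theorems.ScenarioCensus.FrozenTop

open Literature.Analysis Literature.Analysis.FluidPDE
open Summit.NavierStokesRegularity.NavierStokesRegularity.Theorems

/-! ## §7 Rows, Liouville rows, floor, residual; the rows are EXCLUDED; displays; residual ≡ `Row_F1` -/

/-- **Criterion row F1fzq** (`M`-quantitative form: Type I(`M`) + ε(M)-FROZEN TOP ⇒ extension): for every `M`
ONE `ε > 0` such that the frame of `Row_F1` + `IsTypeIBlowupWith M ν u T` + a subcritical level with
`(T − t)² ‖∂ₜω‖ ≤ ε` on its top ⇒ `HasSmoothExtensionPast`.  No pressure, no viscosity in the criterion number.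
PROVED (`rowF1fzq_holds`). -/
def Row_F1fzq : Prop :=
  ∀ M : ℝ, ∃ ε : ℝ, 0 < ε ∧ ∀ (ν T : ℝ), 0 < ν → 0 < T →
    ∀ (u : ℝ → E3 → E3) (p : ℝ → E3 → ℝ),
    IsClassicalNSSolutionOn (Ico 0 T) ν 0 u p → IsLerayHopfOn T ν 0 (u 0) u →
    HasRapidSpatialDecay (u 0) → IsTypeIBlowupWith M ν u T →
    (∃ Λ : ℝ → ℝ, IsSubcriticalLevel T Λ ∧ HasFreezeDefectAt T Λ ε u) →
    HasSmoothExtensionPast ν 0 u T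

/-- **Criterion row F1fz** (`o`-form, the exact frame of `Row_F1` plus ONE hypothesis: an `o`-FROZEN TOP — some
subcritical level on whose top `(T − t)² ‖∂ₜω‖ → 0`, i.e. the freeze defect holds for EVERY `ε > 0`).
PROVED (`rowF1fz_holds`). -/
def Row_F1fz : Prop :=
  ∀ (ν T : ℝ), 0 < ν → 0 < T → ∀ (u : ℝ → E3 → E3) (p : ℝ → E3 → ℝ),
    IsClassicalNSSolutionOn (Ico 0 T) ν 0 u p → IsLerayHopfOn T ν 0 (u 0) u →
    HasRapidSpatialDecay (u 0) → IsTypeIBlowup u T →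
    (∃ Λ : ℝ → ℝ, IsSubcriticalLevel T Λ ∧ ∀ ε : ℝ, 0 < ε → HasFreezeDefectAt T Λ ε u) →
    HasSmoothExtensionPast ν 0 u T

/-- **Ancient row (exact, vorticity-steady slices)**: a `𝒦_C` field each of whose slices solves the steady vorticity
equation `Δω − (W·∇)ω + (ω·∇)W = 0` is trivial.  PROVED (`liouville_vorticitySteady_holds`). -/
def Liouville_vorticitySteady : Prop :=
  ∀ (C : ℝ) (W : ℝ → E3 → E3), IsTypeIAncientMild C W →
    (∀ s < (0 : ℝ), ∀ y : E3,
      (Δ (curl (W s))) y - convect (W s) (curl (W s)) y + convect (curl (W s)) (W s) y = 0) →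
    ∀ s < (0 : ℝ), ∀ y : E3, W s y = 0

/-- **Ancient row (ε-Liouville, almost-steady vorticity)**: ∀ M ∃ ε(M) > 0:
`s² ‖Δω − (W·∇)ω + (ω·∇)W‖ ≤ ε` on the open past ⇒ `W ≡ 0`.  PROVED (`liouville_fzq_holds`). -/
def Liouville_fzq : Prop :=
  ∀ M : ℝ, ∃ ε : ℝ, 0 < ε ∧ ∀ W : ℝ → E3 → E3, IsTypeIAncientMild M W →
    (∀ s < (0 : ℝ), ∀ y : E3, s ^ 2 *
      ‖(Δ (curl (W s))) y - convect (W s) (curl (W s)) y + convect (curl (W s)) (W s) y‖ ≤ ε) →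
    ∀ s < (0 : ℝ), ∀ y : E3, W s y = 0

/-- **LIVE TOP** (structural floor, maximal frame): for every `M` one `ε(M) > 0` such that a maximal Type-I(`M`)
Clay blow-up has, on the top of EVERY subcritical level, no ε-frozen top: the vorticity of the fast fluid keeps
changing at the Type-I rate, `‖∂ₜω‖ > ε (T − t)⁻²`, infinitely often as `t ↑ T`.  PROVED (`liveTop_holds`). -/
def LiveTop : Prop :=
  ∀ M : ℝ, ∃ ε : ℝ, 0 < ε ∧ ∀ (ν T : ℝ), 0 < ν → 0 < T →
    ∀ (u : ℝ → E3 → E3) (p : ℝ → E3 → ℝ),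
    IsMaximalSmoothSolution ν 0 u p T → IsLerayHopfOn T ν 0 (u 0) u →
    HasRapidSpatialDecay (u 0) → IsTypeIBlowupWith M ν u T →
    ∀ Λ : ℝ → ℝ, IsSubcriticalLevel T Λ → ¬ HasFreezeDefectAt T Λ ε u

/-- **Residual** (maximal frame): for every `M` and every `ε > 0`, every maximal Type-I(`M`) Clay blow-up has an
ε-frozen top at some subcritical level.  DECLARED ≡ row F1 (`freezeSlack_iff_rowF1`); no movement on `Row_F1`
is claimed. -/
@[conjecture] def FreezeSlack : Prop :=
  ∀ (M ε : ℝ), 0 < ε → ∀ (ν T : ℝ), 0 < ν → 0 < T →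
    ∀ (u : ℝ → E3 → E3) (p : ℝ → E3 → ℝ),
    IsMaximalSmoothSolution ν 0 u p T → IsLerayHopfOn T ν 0 (u 0) u →
    HasRapidSpatialDecay (u 0) → IsTypeIBlowupWith M ν u T →
    ∃ Λ : ℝ → ℝ, IsSubcriticalLevel T Λ ∧ HasFreezeDefectAt T Λ ε u

/-- **The split**: criterion + residual ⇒ row F1 (by cases on extendability; `M = C/√ν`). -/
theorem rowF1_of (hD : Row_F1fzq) (hR : FreezeSlack) : ScenarioCensus.Row_F1 := by
  unfold ScenarioCensus.Row_F1
  intro ν T hν hT u p hsol hLH hdec hTI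
  obtain ⟨M, hM⟩ := exists_isTypeIBlowupWith hν hTI
  obtain ⟨ε, hε, hrow⟩ := hD M
  by_contra hext
  exact hext (hrow ν T hν hT u p hsol hLH hdec hM (hR M ε hε ν T hν hT u p ⟨hsol, hext⟩ hLH hdec hM))

/-- The residual is a consequence of the row (vacuously: under `Row_F1` no maximal solution is Type I). -/
theorem freezeSlack_of_rowF1 (h : ScenarioCensus.Row_F1) : FreezeSlack :=
  fun _ _ _ ν T hν hT u p hmax hLH hdec hTI =>
    (hmax.2 (h ν T hν hT u p hmax.1 hLH hdec hTI.isTypeIBlowup)).elim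

/-- The `o`-row follows from the `M`-quantitative row. -/
theorem rowF1fz_of_rowF1fzq (h : Row_F1fzq) : Row_F1fz := by
  intro ν T hν hT u p hsol hLH hdec hTI ⟨Λ, hΛ, hall⟩
  obtain ⟨M, hM⟩ := exists_isTypeIBlowupWith hν hTI
  obtain ⟨ε, hε, hrow⟩ := h M
  exact hrow ν T hν hT u p hsol hLH hdec hM ⟨Λ, hΛ, hall ε hε⟩

/-- The Liouville rows hold (in kernel). -/
theorem liouville_vorticitySteady_holds : Liouville_vorticitySteady :=
  fun _ _ hW h => eq_zero_of_vorticitySteady hW h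

/-- The ε-Liouville row (almost-frozen vorticity transport) holds. -/
theorem liouville_fzq_holds : Liouville_fzq := exists_eps_liouville_transport

-- `sing_of_not_bounded`: the line restates the tree's `InviscidTop.sing_of_not_bounded`; taken BY NAME (gate lint dedup.landed).

/-- **Criterion row F1fzq is EXCLUDED** (in kernel): Type I(`M`) + ε(M)-frozen top ⇒ extension. -/
theorem rowF1fzq_holds : Row_F1fzq := by
  intro M
  obtain ⟨ε, hε, hLiou⟩ := exists_eps_liouville_transport M
  refine ⟨ε, hε, fun ν T hν hT u p hsol hLH hdec hTI htop => ?_⟩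
  obtain ⟨Λ, hΛ, hdef⟩ := htop
  have hH : HasJointDefect₄At T Λ ν ε (fun v L H K => ‖vortOf v L H K‖) u :=
    (hasTransportDefectAt_iff_joint hν hT hsol).1 ((hasFreezeDefectAt_iff hT hsol).1 hdef)
  apply hasSmoothExtensionPast_of_forall_exists_parabolicCylinder hν hT hsol hLH hdec
  intro x₀
  by_contra hno
  obtain ⟨α, β, R, c, W, hα, hβ, hR, hαR, hαν, hcpos, hclim, hW, hpt, hgrad, hhess, hlap, t, ht, y, hne⟩ :=
    exists_singularZoom_package₃ hν hT hsol hLH hdec hTI x₀ (InviscidTop.sing_of_not_bounded hno)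
  have hall := joint_transfer_everywhere₄ hW hν hα hβ hαR hαν hcpos hclim hpt hgrad hhess hlap
    (Rd := fun v L H K => ‖vortOf v L H K‖) continuous_vortOf.norm
    (fun a ha v L H K => by
      show ‖vortOf (a • v) (a ^ 2 • L) (a ^ 3 • H) (a ^ 4 • K)‖ = a ^ 4 * ‖vortOf v L H K‖
      rw [vortOf_smul, norm_smul, Real.norm_eq_abs, abs_of_pos (pow_pos ha 4)])
    (by show ‖vortOf 0 0 0 0‖ = 0; simp [vortOf]) hε.le hΛ hH
  exact hne (hLiou W hW (fun s hs y' => by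
    rw [transport_eq_vortOf ((hW.contDiff_slice hs).of_le (by norm_cast))]; exact hall s hs y') t ht y)

/-- The `o`-row holds (in kernel). -/
theorem rowF1fz_holds : Row_F1fz := rowF1fz_of_rowF1fzq rowF1fzq_holds

/-- **The floor LIVE TOP holds.** -/
theorem liveTop_holds : LiveTop := by
  intro M
  obtain ⟨ε, hε, h⟩ := rowF1fzq_holds M
  exact ⟨ε, hε, fun ν T hν hT u p hmax hLH hdec hTI Λ hΛ hfr =>
    hmax.2 (h ν T hν hT u p hmax.1 hLH hdec hTI ⟨Λ, hΛ, hfr⟩)⟩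

/-- **LIVE TOP, unfolded** (display, constant levels): ∀ M ∃ ε(M) > 0: in the maximal Type-I(`M`) Clay frame, for
EVERY speed `Λ` and every `t₁ < T` some `t ∈ (t₁, T)` has a `Λ`-fast point with `(T − t)² ‖∂ₜω(t, x)‖ > ε` — the
vorticity of the fast fluid of a Type-I blow-up never freezes at the Type-I time scale. -/
theorem liveTop_unfolded : ∀ M : ℝ, ∃ ε : ℝ, 0 < ε ∧ ∀ (ν T : ℝ), 0 < ν → 0 < T →
    ∀ (u : ℝ → E3 → E3) (p : ℝ → E3 → ℝ),
    IsMaximalSmoothSolution ν 0 u p T → IsLerayHopfOn T ν 0 (u 0) u →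
    HasRapidSpatialDecay (u 0) → IsTypeIBlowupWith M ν u T →
    ∀ Λ : ℝ, ∀ t₁ : ℝ, t₁ < T →
      ∃ t ∈ Ioo t₁ T, ∃ x : E3, Λ < ‖u t x‖ ∧
        ε < (T - t) ^ 2 * ‖timeDerivWithin (Ico 0 T) (vorticity u) t x‖ := by
  intro M
  obtain ⟨ε, hε, hfl⟩ := liveTop_holds M
  refine ⟨ε, hε, fun ν T hν hT u p hmax hLH hdec hTI Λ t₁ ht₁ => ?_⟩
  by_contra hno
  push Not at hno
  refine hfl ν T hν hT u p hmax hLH hdec hTI (fun _ => Λ) (isSubcriticalLevel_const T Λ) ?_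
  exact eventually_of_mem (Ioo_mem_nhdsLT ht₁) fun t ht x hx => hno t ht x hx

/-- **LIVE TOP, kinematic display**: the same with the number written through the vorticity equation,
`(T − t)² ‖ν Δω − (u·∇)ω + (ω·∇)u‖ > ε` at a fast point. -/
theorem liveTop_unfolded_transport : ∀ M : ℝ, ∃ ε : ℝ, 0 < ε ∧ ∀ (ν T : ℝ), 0 < ν → 0 < T →
    ∀ (u : ℝ → E3 → E3) (p : ℝ → E3 → ℝ),
    IsMaximalSmoothSolution ν 0 u p T → IsLerayHopfOn T ν 0 (u 0) u →
    HasRapidSpatialDecay (u 0) → IsTypeIBlowupWith M ν u T →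
    ∀ Λ : ℝ, ∀ t₁ : ℝ, t₁ < T →
      ∃ t ∈ Ioo t₁ T, ∃ x : E3, Λ < ‖u t x‖ ∧
        ε < (T - t) ^ 2 *
          ‖ν • (Δ (curl (u t))) x - convect (u t) (curl (u t)) x + convect (curl (u t)) (u t) x‖ := by
  intro M
  obtain ⟨ε, hε, hfl⟩ := liveTop_unfolded M
  refine ⟨ε, hε, fun ν T hν hT u p hmax hLH hdec hTI Λ t₁ ht₁ => ?_⟩
  obtain ⟨t, ht, x, hx, hlt⟩ := hfl ν T hν hT u p hmax hLH hdec hTI Λ (max t₁ 0) (max_lt ht₁ hT)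
  refine ⟨t, ⟨(le_max_left _ _).trans_lt ht.1, ht.2⟩, x, hx, ?_⟩
  rw [freeze_eq hT hmax.1 ⟨((le_max_right _ _).trans_lt ht.1).le, ht.2⟩ x]
  exact hlt

-- `vorticitySteady_ancient_trivial`: the line restates the tree's `eq_zero_of_vorticitySteady`; taken BY NAME (gate lint dedup.landed).

/-- The residual is EXACTLY row F1 (declared; no movement on `Row_F1` is claimed). -/
theorem freezeSlack_iff_rowF1 : FreezeSlack ↔ ScenarioCensus.Row_F1 :=
  ⟨rowF1_of rowF1fzq_holds, freezeSlack_of_rowF1⟩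

/-- Deciding direction used by the split. -/
theorem rowF1_of_freezeSlack : FreezeSlack → ScenarioCensus.Row_F1 :=
  rowF1_of rowF1fzq_holds

end Summit.NavierStokesRegularity.NavierStokesRegularity.Theorems.ScenarioCensus.FrozenTop

namespace Summit.NavierStokesRegularity.NavierStokesRegularity.Theorems.ScenarioCensus

/-! ## Census KEYS (ns `…Theorems.ScenarioCensus`): the FROZEN-TOP family of row F1 — TREE-decided members -/

/-- **Cell F1fzq** (row F1 frame VERBATIM + Type I(`M`) + ε(M)-frozen top `(T−t)²‖∂ₜω‖ ≤ ε(M)` on the top of one subcritical level ⇒ smooth extension past `T`): `:= FrozenTop.Row_F1fzq`. DECIDED. -/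
def Row_F1fzq : Prop := FrozenTop.Row_F1fzq
/-- F1fzq is EXCLUDED (decided in the tree): `FrozenTop.rowF1fzq_holds`. -/
theorem row_F1fzq_excluded : Row_F1fzq := FrozenTop.rowF1fzq_holds

/-- **Cell F1fz** (o-form: `(T−t)²‖∂ₜω‖ → 0` on the top of one subcritical level): `:= FrozenTop.Row_F1fz`. DECIDED. -/
def Row_F1fz : Prop := FrozenTop.Row_F1fz
/-- F1fz is EXCLUDED (decided in the tree): `FrozenTop.rowF1fz_holds`. -/
theorem row_F1fz_excluded : Row_F1fz := FrozenTop.rowF1fz_holds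

/-- **Floor LIVE TOP** at the level of the census keys: `FrozenTop.liveTop_holds`. -/
theorem row_F1_liveTop : FrozenTop.LiveTop := FrozenTop.liveTop_holds

end Summit.NavierStokesRegularity.NavierStokesRegularity.Theorems.ScenarioCensus

end
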